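import Mathlib
import Summits.ResolutionOfSingularities.ResolutionOfSingularities.Theorems.SyzygyFlatteningDefs
import Summits.ResolutionOfSingularities.ResolutionOfSingularities.Theorems.SyzygyFlatteningHigherRankTerminationTowerStageBasic
import Summits.ResolutionOfSingularities.ResolutionOfSingularities.Theorems.SyzygyFlatteningHigherRankTerminationLocAt
import Summits.ResolutionOfSingularities.ResolutionOfSingularities.Theorems.SyzygyFlatteningHigherRankTerminationTowerLocalisation
import HarnessLib

/-!
# If the tower exhausts `O`, a coarsening with a regular stage IS that stage

Crux `SyzygyFlattening.HigherRankTermination` (stmt-ResolutionOfSingularities-17045), line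
`birth`, registered glue stub `stub_coarsening_eq_stage_of_union`.

Let `k ⊆ O ≤ O₁` be valuation rings of `K`, `A ⊆ O` a finitely generated model with
`Frac A = K`, and suppose the syzygy-flattening tower along `O`
(`Theorems/SyzygyFlatteningDefs.lean`) EXHAUSTS `O`: every `x ∈ O` lies in some stage
`tower O A m`. If the tower along the coarsening `O₁` has a regular stage `m₀`, then
`O₁ = tower O₁ A m₀` as subrings of `K` — so `O₁` is a regular (noetherian) local ring, i.e. in a
would-be counterexample the rank-one coarsening is the discrete valuation ring of a prime divisor.

Proof. `⊇` is `tower_toSubring_le` (every stage along `O₁` lies in `O₁`). For `⊆`, the two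
landed facts `towerLocalisation` (`locAt O₁ (tower O A m) = tower O₁ A m`, the tower along `O₁`
is the `O`-tower localised at the centres of `O₁`) and `tower_eq_of_regular` (a regular stage is
terminal) give `locAt O₁ (tower O A (m₀ + m)) = tower O₁ A m₀` for every `m`
(`locAt_tower_late_eq_of_regular`). Now let `x ∈ O₁`. Either `x ∈ O`, and then `x` lies in a
late stage `tower O A (m₀ + m) ≤ locAt O₁ (tower O A (m₀ + m))` (`tower_mono`, `self_le_locAt`);
or `x⁻¹ ∈ O` (`O` is a valuation ring), and then `x⁻¹` lies in a late stage and is inverted in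
its localisation at the centre of `O₁` because `(x⁻¹)⁻¹ = x ∈ O₁` (`mul_inv_mem_locAt`). In both
cases `x ∈ tower O₁ A m₀`. [folklore]
-/

noncomputable section

-- single-problem summit: the doubled namespace component `ResolutionOfSingularities` is forced
set_option linter.dupNamespace false

namespace Summit.ResolutionOfSingularities.ResolutionOfSingularities.Theorems.SyzygyFlattening

variable {k K : Type} [Field k] [Field K] [Algebra k K]

/-- **Late stages localise to the regular stage.** For `k ⊆ O ≤ O₁`, `A ⊆ O` finitely generated
with `Frac A = K`, and a regular stage `m₀` of the tower along `O₁`: every later stage of the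
`O`-tower, localised at the centre of `O₁`, is that regular stage,
`locAt O₁ (tower O A (m₀ + m)) = tower O₁ A m₀` (`towerLocalisation` and `tower_eq_of_regular`).
[folklore] -/
theorem locAt_tower_late_eq_of_regular (O O₁ : ValuationSubring K) (A : Subalgebra k K)
    (hk : ∀ c : k, algebraMap k K c ∈ O) (hFG : A.FG) (hFrac : IsFractionRing ↥A K)
    (hAO : A.toSubring ≤ O.toSubring) (hOO₁ : O ≤ O₁) (m₀ : ℕ)
    (hreg : IsRegularLocalRing ↥(tower O₁ A m₀)) (m : ℕ) :
    locAt O₁ (tower O A (m₀ + m)) = tower O₁ A m₀ := by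
  rw [towerLocalisation O A hk hFG hFrac hAO O₁ hOO₁ (m₀ + m)]
  exact tower_eq_of_regular O₁ A (fun c => hOO₁ (hk c)) hFrac (fun x hx => hOO₁ (hAO hx)) m₀
    hreg m

/-- **An element of `O₁` whose inverse lies in a model `B` lies in `locAt O₁ B`**:
`x = 1 * (x⁻¹)⁻¹` with `1, x⁻¹ ∈ B` and `(x⁻¹)⁻¹ = x ∈ O₁` (`mul_inv_mem_locAt`). [folklore] -/
theorem mem_locAt_of_inv_mem (O₁ : ValuationSubring K) (B : Subalgebra k K) {x : K}
    (hxB : x⁻¹ ∈ B) (hx : x ∈ O₁) : x ∈ locAt O₁ B := by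
  have h := mul_inv_mem_locAt O₁ B B.one_mem hxB (by rwa [inv_inv])
  rwa [inv_inv, one_mul] at h

/-- **If the `O`-tower exhausts `O`, every element of a coarsening `O₁ ⊇ O` lies in
`locAt O₁` of a late stage.** For `x ∈ O₁`: either `x ∈ O` lies in a stage, enlarged past `m₀`
by `tower_mono`, and a stage embeds in its localisation (`self_le_locAt`); or `x⁻¹ ∈ O`
(`O.mem_or_inv_mem`) lies in a late stage and `x = (x⁻¹)⁻¹` is inverted there
(`mem_locAt_of_inv_mem`). [folklore] -/
theorem exists_mem_locAt_tower_of_union (O O₁ : ValuationSubring K) (A : Subalgebra k K)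
    (hU : ∀ x : K, x ∈ O → ∃ m : ℕ, x ∈ tower O A m) (m₀ : ℕ) {x : K} (hx : x ∈ O₁) :
    ∃ m : ℕ, x ∈ locAt O₁ (tower O A (m₀ + m)) := by
  -- every element of `O` lies in a LATE stage `m₀ + m`
  have hlate : ∀ y : K, y ∈ O → ∃ m : ℕ, y ∈ tower O A (m₀ + m) := fun y hy => by
    obtain ⟨m, hm⟩ := hU y hy
    exact ⟨m, tower_mono O A (Nat.le_add_left m m₀) hm⟩
  rcases O.mem_or_inv_mem x with hxO | hxO
  · obtain ⟨m, hm⟩ := hlate x hxO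
    exact ⟨m, self_le_locAt O₁ _ hm⟩
  · obtain ⟨m, hm⟩ := hlate x⁻¹ hxO
    exact ⟨m, mem_locAt_of_inv_mem O₁ _ hm hx⟩

/-- **STUB `stub_coarsening_eq_stage_of_union` (glue, v13) — PROVED.** If the tower along `O`
exhausts `O` and the tower along a coarsening `O₁ ⊇ O` has a regular stage `m₀`, then `O₁` IS
that stage: for `x ∈ O₁`, either `x ∈ O`, so `x` lies in a late stage
`T_m ≤ locAt O₁ T_m = tower O₁ A m = tower O₁ A m₀` (`towerLocalisation`, `tower_eq_of_regular`),
or `x⁻¹ ∈ O` is an `O₁`-unit lying in a late stage, so `x = (x⁻¹)⁻¹ ∈ locAt O₁ T_m`; and every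
stage along `O₁` lies in `O₁` (`tower_toSubring_le`). Hence in an exhausted counterexample the
rank-one coarsening is a regular local ring, i.e. the discrete valuation ring of a prime divisor.
[folklore] -/
theorem stub_coarsening_eq_stage_of_union : ∀ (k K : Type) [Field k] [Field K] [Algebra k K]
    (O O₁ : ValuationSubring K) (A : Subalgebra k K), (∀ c : k, algebraMap k K c ∈ O) → A.FG →
      IsFractionRing ↥A K → A.toSubring ≤ O.toSubring → O ≤ O₁ →
      (∀ x : K, x ∈ O → ∃ m : ℕ, x ∈ tower O A m) →
      ∀ m₀ : ℕ, IsRegularLocalRing ↥(tower O₁ A m₀) → O₁.toSubring = (tower O₁ A m₀).toSubring := by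
  intro k K _ _ _ O O₁ A hk hFG hFrac hAO hOO₁ hU m₀ hreg
  refine le_antisymm ?_
    (tower_toSubring_le O₁ (fun c => hOO₁ (hk c)) (fun x hx => hOO₁ (hAO hx)) m₀)
  intro x hx
  obtain ⟨m, hm⟩ :=
    exists_mem_locAt_tower_of_union O O₁ A hU m₀ ((O₁.mem_toSubring x).mp hx)
  rw [locAt_tower_late_eq_of_regular O O₁ A hk hFG hFrac hAO hOO₁ m₀ hreg m] at hm
  exact Subalgebra.mem_toSubring.mpr hm

end Summit.ResolutionOfSingularities.ResolutionOfSingularities.Theorems.SyzygyFlattening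

end
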